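import Summits.HodgeConjecture.HodgeConjecture.Theorems.MarkmanPartnerTransportHodgeClassesModKappaClassesAnyDegree
import Summits.HodgeConjecture.HodgeConjecture.Theorems.MarkmanPartnerTransportOrphanSR

/-!
# Route MarkmanPartnerTransport · crux #5 `LowPicardRealMultiplication` — each cell `CellHC[ρ, d]` is EXACTLY the
# algebraicity of the kappa class `κ_θ` of the generator on that cell

Programme «RM-GEN + CELL-SPLIT», third brick «cellHC_iff_kappaClass» (planner p1 g38); route-independent (no
`Theses` import: the notations `RMgen[…]`, `CellHC[…]` of `…LowPicardRMCells` are copied verbatim). On the cell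
`(ρ(X), [E:ℚ]) = (ρ, d)` of crux #5 the generator `θ` of «RM-GEN» (`RMgen[X, φ, z, d]`: rational, type-preserving,
`q`-self-adjoint, `E = ℚ[θ|_T]` by the GEN clause) feeds KAPPA-ANY (`…HodgeClassesModKappaClassesAnyDegree`), whose
`hgen` binder IS the GEN clause:

* `cellKappa_of_cellHC` — `CellHC[ρ, d] → CellKappa[ρ, d]` (HC⁴ on the cell ⟹ `κ_θ ∈ A²(X)` on the cell; FACT-FREE:
  `κ_θ` is a rational `(2,2)`-class, `OrphanSR.kappaClass_mem_algebraicClasses_of_hodgeConjectureFor`);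
* `cellHC_of_cellKappa` — `CellKappa[ρ, d] → CellHC[ρ, d]` modulo {Verbitsky–Guan, O'Grady 2008, Charles–Markman 2013}
  (KAPPA-IFF-ANY′ `hodgeConjectureFor_iff_kappaClass_mem_algebraicClasses_of_polynomialGeneration`);
* `cellHC_iff_cellKappa` — **`CellHC[ρ, d] ↔ CellKappa[ρ, d]`** modulo the same three facts;
* `cellHC_iff_cellKappaPow` — the Charles–Markman-FREE form `CellHC[ρ, d] ↔ CellKappaPow[ρ, d]` (all `κ_{θᵏ}`
  algebraic; KAPPA-IFF-ANY `hodgeConjectureFor_iff_forall_kappaClass_pow_mem_algebraicClasses`), modulo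
  {Verbitsky–Guan, O'Grady 2008};
* (the by-name closer `lowPicardRealMultiplication_of_six_kappa_cells` — crux #5 from `κ_θ ∈ A²(X)` on the six
  cells — is appended to `…LowPicardRMCells`, the only file of the programme importing the route file).

So the ONE missing object in each cell is an algebraic source for the single explicit class
`κ_θ = Σᵢⱼ (G⁻¹)ᵢⱼ φ⁻¹eᵢ ∪ θ(φ⁻¹eⱼ)`. CONDITIONAL on the named facts displayed; no definition, no sorry; credits
nothing to the Hodge conjecture. Prover seat hodge-nonav-20241-p1 (gen 14), `--supports stmt-HodgeConjecture-19653`.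

References: E. Markman, JEMS (2024) §1.1 Thm. 1.1; F. Charles, E. Markman, Compos. Math. 149 (2013) Thm. 1.1;
K. O'Grady, Commun. Contemp. Math. 10 (2008) §2–3; Yu. Zarhin, J. reine angew. Math. 341 (1983) Thm. 1.5.1.
-/

noncomputable section

set_option linter.dupNamespace false

open Module CategoryTheory
open Literature.AlgebraicTopology.SingularHomology Literature.Geometry.Kaehler
open Literature.AlgebraicGeometry Literature.AlgebraicGeometry.Motives Literature.AlgebraicGeometry.HodgeTheory
open Literature.AlgebraicGeometry.Hyperkaehler Literature.AlgebraicGeometry.Surfaces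
open Summit.HodgeConjecture.HodgeConjecture.Theorems.NikulinTwinTransport
open Summit.HodgeConjecture.HodgeConjecture.Theorems.MarkmanPartnerTransport.BBFPositivity

namespace Summit.HodgeConjecture.HodgeConjecture.Theorems.MarkmanPartnerTransport.PartnerLattice

/-- `MarkedK3Sq[X, φ, P, z]`: VERBATIM the `let MarkedK3Sq := …` binder of the route declarations of
MarkmanPartnerTransport (clauses (m1)–(m6)). Local notation only. -/
local notation3 (prettyPrint := false) "MarkedK3Sq[" X ", " φ ", " P ", " z "]" =>
  (((IsIntegralClass P ∧ ∀ Q : complexBetti X (2 * 4), IsIntegralClass Q → ∃ n : ℤ, Q = n • P) ∧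
    (∀ c : complexBetti X 2, IsIntegralClass c ↔ ∃ v : K3HilbertIndex → ℤ, φ c = fun i => (v i : ℂ)) ∧
    (∀ a : complexBetti X 2, cupPowTwo a 4 = ((3 : ℂ) * (k3HilbertForm 2 (φ a) (φ a)) ^ 2) • P) ∧
    (IsOfHodgeType 4 X 2 2 0 (LinearEquiv.symm φ z) ∧
      ∀ τ : complexBetti X 2, IsOfHodgeType 4 X 2 2 0 τ → ∃ t : ℂ, τ = t • LinearEquiv.symm φ z) ∧
    (∀ c : complexBetti X 2, IsOfHodgeType 4 X 2 1 1 c ↔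
      (k3HilbertForm 2 (φ c) z = 0 ∧ k3HilbertForm 2 (φ c) (star z) = 0)) ∧
    (k3HilbertForm 2 z z = 0 ∧ 0 < (k3HilbertForm 2 (star z) z).re)))

/-- `SpIso[X, φ]`: VERBATIM the `let SpannedByIsometries := …` binder of the route declarations (with
`IsBBFTransc` unfolded). Local notation only. -/
local notation3 (prettyPrint := false) "SpIso[" X ", " φ "]" =>
  (∀ f : complexBetti X 2 →ₗ[ℂ] complexBetti X 2, (∀ y, IsRationalClass y → IsRationalClass (f y)) →
    (∀ (i j : ℕ) y, IsOfHodgeType 4 X 2 i j y → IsOfHodgeType 4 X 2 i j (f y)) →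
    (∀ d : complexBetti X 2, d ∈ algebraicClasses X 1 → f d = 0) →
    (∀ y : complexBetti X 2, ∀ d : complexBetti X 2, d ∈ algebraicClasses X 1 →
      k3HilbertForm 2 (φ (f y)) (φ d) = 0) →
    ∃ (k : ℕ) (c : Fin k → ℚ) (g : Fin k → (complexBetti X 2 →ₗ[ℂ] complexBetti X 2)),
      (∀ i, Function.Bijective (g i) ∧ (∀ y, IsRationalClass y → IsRationalClass (g i y)) ∧
        (∀ (a b : ℕ) y, IsOfHodgeType 4 X 2 a b y → IsOfHodgeType 4 X 2 a b (g i y)) ∧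
        (∀ a b, k3HilbertForm 2 (φ (g i a)) (φ (g i b)) = k3HilbertForm 2 (φ a) (φ b))) ∧
      ∀ y : complexBetti X 2, (∀ d : complexBetti X 2, d ∈ algebraicClasses X 1 →
        k3HilbertForm 2 (φ y) (φ d) = 0) → f y = ∑ i : Fin k, ((c i : ℂ) • g i y))

/-- `RMgen[X, φ, z, d]` («RMgen» data, the `RMGenData` of Sketch P1AK-CELLS with self-adjointness added): a
rational, type-preserving, `q`-self-adjoint endomorphism `θ` of `H²(X(ℂ); ℂ)` with `θ σ = ev · σ`, `ev` real,
`deg minpoly_ℚ(ev) = d`, `d · n + ρ(X) = 23` for some `n ≥ 3`, and GEN: every rational type-preserving endomorphism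
is `Σ_{i<d} cᵢ θⁱ` (`cᵢ ∈ ℚ`) on `T(X)_ℂ = {y : q(φ y, φ N¹(X)) = 0}`. Local notation only. -/
local notation3 (prettyPrint := false) "RMgen[" X ", " φ ", " z ", " d "]" =>
  (∃ θ : complexBetti X 2 →ₗ[ℂ] complexBetti X 2, (∀ y, IsRationalClass y → IsRationalClass (θ y)) ∧
    (∀ (i j : ℕ) y, IsOfHodgeType 4 X 2 i j y → IsOfHodgeType 4 X 2 i j (θ y)) ∧
    (∀ y w : complexBetti X 2, k3HilbertForm 2 (φ (θ y)) (φ w) = k3HilbertForm 2 (φ y) (φ (θ w))) ∧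
    ∃ ev : ℂ, θ (LinearEquiv.symm φ z) = ev • LinearEquiv.symm φ z ∧ ev.im = 0 ∧
      (minpoly ℚ ev).natDegree = d ∧
      (∃ n : ℕ, 3 ≤ n ∧ d * n + Module.finrank ℂ ↥(algebraicClasses X 1) = 23) ∧
      ∀ f : complexBetti X 2 →ₗ[ℂ] complexBetti X 2, (∀ y, IsRationalClass y → IsRationalClass (f y)) →
        (∀ (i j : ℕ) y, IsOfHodgeType 4 X 2 i j y → IsOfHodgeType 4 X 2 i j (f y)) →
        ∃ c : Fin d → ℚ, ∀ y : complexBetti X 2,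
          (∀ a : complexBetti X 2, a ∈ algebraicClasses X 1 → k3HilbertForm 2 (φ y) (φ a) = 0) →
            f y = ∑ i : Fin d, ((c i : ℂ) • (θ ^ (i : ℕ)) y))

/-- `Kap[φ, g] = Σ_{ij} (G⁻¹)_{ij} · φ⁻¹eᵢ ∪ g(φ⁻¹eⱼ) ∈ H⁴(X(ℂ); ℂ)`, the kappa class of an endomorphism `g`
of `H²(X(ℂ); ℂ)` (VERBATIM `…K3Sq2TypeHodgeGraphClassesGeneral`). Local notation only. -/
local notation3 (prettyPrint := false) "Kap[" φ ", " g "]" =>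
  (∑ i : K3HilbertIndex, ∑ j : K3HilbertIndex,
    (((k3HilbertGram 2).map (Int.cast : ℤ → ℂ))⁻¹ i j) •
      cupProduct (rfl : 2 + 2 = 2 * 2) ((LinearEquiv.symm φ) (Pi.single i 1))
        (g ((LinearEquiv.symm φ) (Pi.single j 1))))

/-- `CellHC[ρ, d]`: **HC⁴ on the cell `(ρ(X), [E:ℚ]) = (ρ, d)`** — for every marked smooth projective `K3^{[2]}`-type
`(X, φ, P, z)` with `¬ SpannedByIsometries`, `ρ(X) = ρ` and `RMgen[X, φ, z, d]` (the `InCell`/`CellHC` of Sketch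
P1AK-CELLS, curried), `HodgeConjectureFor 4 X`. Local notation only. -/
local notation3 (prettyPrint := false) "CellHC[" ρ ", " d "]" =>
  (∀ (X : SchemeOver ℂ), IsSmoothProjective 4 X → IsOfK3HilbertSquareType X →
    ∀ (φ : complexBetti X 2 ≃ₗ[ℂ] (K3HilbertIndex → ℂ)) (P : complexBetti X (2 * 4)) (z : K3HilbertIndex → ℂ),
      MarkedK3Sq[X, φ, P, z] → ¬ SpIso[X, φ] → Module.finrank ℂ ↥(algebraicClasses X 1) = ρ →
        RMgen[X, φ, z, d] → HodgeConjectureFor 4 X)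

/-- `CellKappa[ρ, d]`: **`κ_θ ∈ A²(X)` on the cell `(ρ, d)`** — for every marked smooth projective `K3^{[2]}`-type
`(X, φ, P, z)` with `¬ SpannedByIsometries`, `ρ(X) = ρ`, and every `θ` carrying the data of `RMgen[X, φ, z, d]`, the
kappa class `κ_θ` is algebraic. Local notation only. -/
local notation3 (prettyPrint := false) "CellKappa[" ρ ", " d "]" =>
  (∀ (X : SchemeOver ℂ), IsSmoothProjective 4 X → IsOfK3HilbertSquareType X →
    ∀ (φ : complexBetti X 2 ≃ₗ[ℂ] (K3HilbertIndex → ℂ)) (P : complexBetti X (2 * 4)) (z : K3HilbertIndex → ℂ),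
      MarkedK3Sq[X, φ, P, z] → ¬ SpIso[X, φ] → Module.finrank ℂ ↥(algebraicClasses X 1) = ρ →
        ∀ θ : complexBetti X 2 →ₗ[ℂ] complexBetti X 2, (∀ y, IsRationalClass y → IsRationalClass (θ y)) →
          (∀ (i j : ℕ) y, IsOfHodgeType 4 X 2 i j y → IsOfHodgeType 4 X 2 i j (θ y)) →
          (∀ y w : complexBetti X 2, k3HilbertForm 2 (φ (θ y)) (φ w) = k3HilbertForm 2 (φ y) (φ (θ w))) →
          (∃ ev : ℂ, θ (LinearEquiv.symm φ z) = ev • LinearEquiv.symm φ z ∧ ev.im = 0 ∧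
            (minpoly ℚ ev).natDegree = d ∧
            (∃ n : ℕ, 3 ≤ n ∧ d * n + Module.finrank ℂ ↥(algebraicClasses X 1) = 23) ∧
            ∀ f : complexBetti X 2 →ₗ[ℂ] complexBetti X 2, (∀ y, IsRationalClass y → IsRationalClass (f y)) →
              (∀ (i j : ℕ) y, IsOfHodgeType 4 X 2 i j y → IsOfHodgeType 4 X 2 i j (f y)) →
              ∃ c : Fin d → ℚ, ∀ y : complexBetti X 2,
                (∀ a : complexBetti X 2, a ∈ algebraicClasses X 1 → k3HilbertForm 2 (φ y) (φ a) = 0) →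
                  f y = ∑ i : Fin d, ((c i : ℂ) • (θ ^ (i : ℕ)) y)) →
          Kap[φ, θ] ∈ algebraicClasses X 2)

/-- `CellKappaPow[ρ, d]`: **`κ_{θᵏ} ∈ A²(X)` for all `k` on the cell `(ρ, d)`** (same binders as `CellKappa`). Local
notation only. -/
local notation3 (prettyPrint := false) "CellKappaPow[" ρ ", " d "]" =>
  (∀ (X : SchemeOver ℂ), IsSmoothProjective 4 X → IsOfK3HilbertSquareType X →
    ∀ (φ : complexBetti X 2 ≃ₗ[ℂ] (K3HilbertIndex → ℂ)) (P : complexBetti X (2 * 4)) (z : K3HilbertIndex → ℂ),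
      MarkedK3Sq[X, φ, P, z] → ¬ SpIso[X, φ] → Module.finrank ℂ ↥(algebraicClasses X 1) = ρ →
        ∀ θ : complexBetti X 2 →ₗ[ℂ] complexBetti X 2, (∀ y, IsRationalClass y → IsRationalClass (θ y)) →
          (∀ (i j : ℕ) y, IsOfHodgeType 4 X 2 i j y → IsOfHodgeType 4 X 2 i j (θ y)) →
          (∀ y w : complexBetti X 2, k3HilbertForm 2 (φ (θ y)) (φ w) = k3HilbertForm 2 (φ y) (φ (θ w))) →
          (∃ ev : ℂ, θ (LinearEquiv.symm φ z) = ev • LinearEquiv.symm φ z ∧ ev.im = 0 ∧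
            (minpoly ℚ ev).natDegree = d ∧
            (∃ n : ℕ, 3 ≤ n ∧ d * n + Module.finrank ℂ ↥(algebraicClasses X 1) = 23) ∧
            ∀ f : complexBetti X 2 →ₗ[ℂ] complexBetti X 2, (∀ y, IsRationalClass y → IsRationalClass (f y)) →
              (∀ (i j : ℕ) y, IsOfHodgeType 4 X 2 i j y → IsOfHodgeType 4 X 2 i j (f y)) →
              ∃ c : Fin d → ℚ, ∀ y : complexBetti X 2,
                (∀ a : complexBetti X 2, a ∈ algebraicClasses X 1 → k3HilbertForm 2 (φ y) (φ a) = 0) →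
                  f y = ∑ i : Fin d, ((c i : ℂ) • (θ ^ (i : ℕ)) y)) →
          ∀ k : ℕ, Kap[φ, θ ^ k] ∈ algebraicClasses X 2)

/-! ### HC⁴ on a cell ⟹ the kappa classes are algebraic (fact-free) -/

/-- **`CellHC[ρ, d] → CellKappaPow[ρ, d]`**: if HC⁴ holds on the cell, every `κ_{θᵏ}` is algebraic on it — a rational
`(2,2)`-class (`isRationalClass_kappaClass`, `isOfHodgeType_kappaClass` on the powers of `θ`). FACT-FREE.
[cite: Markman2024, §1.1 Thm. 1.1] [cite: OGrady2008NumericalK3Square, §2.2] -/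
theorem cellKappaPow_of_cellHC {ρ d : ℕ} (h : CellHC[ρ, d]) : CellKappaPow[ρ, d] := by
  intro X hX hK φ P z hM hsp hρ θ h1 h2 h5 hdata k
  exact OrphanSR.kappaClass_mem_algebraicClasses_of_hodgeConjectureFor hX hM
    (h X hX hK φ P z hM hsp hρ ⟨θ, h1, h2, h5, hdata⟩) (θ ^ k) (isRationalClass_pow_apply θ h1 k)
    (isOfHodgeType_pow_apply θ h2 k)

/-- **`CellHC[ρ, d] → CellKappa[ρ, d]`**: if HC⁴ holds on the cell, `κ_θ` is algebraic on it. FACT-FREE.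
[cite: Markman2024, §1.1 Thm. 1.1] [cite: OGrady2008NumericalK3Square, §2.2] -/
theorem cellKappa_of_cellHC {ρ d : ℕ} (h : CellHC[ρ, d]) : CellKappa[ρ, d] := by
  intro X hX hK φ P z hM hsp hρ θ h1 h2 h5 hdata
  simpa only [pow_one] using cellKappaPow_of_cellHC h X hX hK φ P z hM hsp hρ θ h1 h2 h5 hdata 1

/-! ### The kappa classes algebraic on a cell ⟹ HC⁴ on the cell -/

/-- **`CellKappaPow[ρ, d] → CellHC[ρ, d]`** (Charles–Markman-FREE): all `κ_{θᵏ}` algebraic on the cell ⟹ HC⁴ on the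
cell, by KAPPA-IFF-ANY with `hgen :=` the GEN clause of `RMgen`. Modulo {Verbitsky–Guan, O'Grady 2008}.
[cite: Novario2026HodgeClassesHilbertSquares, Thm. 6.2 and §4] [cite: OGrady2008NumericalK3Square, §3] -/
theorem cellHC_of_cellKappaPow {ρ d : ℕ} (hV : VerbitskyGuan_cohomology_K3HilbertSquareType)
    (hO : OGrady2008_dualBBFClass_algebraic) (h : CellKappaPow[ρ, d]) : CellHC[ρ, d] := by
  intro X hX hK φ P z hM hsp hρ hgen
  obtain ⟨θ, h1, h2, h5, hdata⟩ := hgen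
  obtain ⟨ev, hev, hevim, hdeg, hn, hG⟩ := id hdata
  exact (hodgeConjectureFor_iff_forall_kappaClass_pow_mem_algebraicClasses hV hO hX hK hM θ h1 h2 h5
    (fun f hf1 hf2 _ _ => ⟨d, hG f hf1 hf2⟩)).2 (h X hX hK φ P z hM hsp hρ θ h1 h2 h5 hdata)

/-- **`CellKappa[ρ, d] → CellHC[ρ, d]`**: `κ_θ` algebraic on the cell ⟹ HC⁴ on the cell, by KAPPA-IFF-ANY′ (T3C: `θ`
is cycle-induced; F4) with `hgen :=` the GEN clause of `RMgen`. Modulo {Verbitsky–Guan, O'Grady 2008,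
Charles–Markman 2013}. [cite: CharlesMarkman2013, Thm. 1.1 (§1)] [cite: Markman2024, §1.1 Thm. 1.1] -/
theorem cellHC_of_cellKappa {ρ d : ℕ} (hV : VerbitskyGuan_cohomology_K3HilbertSquareType)
    (hO : OGrady2008_dualBBFClass_algebraic) (hB : CharlesMarkman2013_lefschetzStandard_K3HilbertType)
    (h : CellKappa[ρ, d]) : CellHC[ρ, d] := by
  intro X hX hK φ P z hM hsp hρ hgen
  obtain ⟨θ, h1, h2, h5, hdata⟩ := hgen
  obtain ⟨ev, hev, hevim, hdeg, hn, hG⟩ := id hdata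
  exact (hodgeConjectureFor_iff_kappaClass_mem_algebraicClasses_of_polynomialGeneration hV hO hB hX hK hM θ h1 h2 h5
    (fun f hf1 hf2 _ _ => ⟨d, hG f hf1 hf2⟩)).2 (h X hX hK φ P z hM hsp hρ θ h1 h2 h5 hdata)

/-- **`CellHC[ρ, d] ↔ CellKappa[ρ, d]`: HC⁴ on a cell of crux #5 is EXACTLY the algebraicity of the one class `κ_θ`
on that cell** (`θ` the generator of «RM-GEN»). Modulo {Verbitsky–Guan, O'Grady 2008, Charles–Markman 2013} (used by
`←` only). [cite: CharlesMarkman2013, Thm. 1.1 (§1)] [cite: Markman2024, §1.1 Thm. 1.1] -/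
theorem cellHC_iff_cellKappa {ρ d : ℕ} (hV : VerbitskyGuan_cohomology_K3HilbertSquareType)
    (hO : OGrady2008_dualBBFClass_algebraic) (hB : CharlesMarkman2013_lefschetzStandard_K3HilbertType) :
    CellHC[ρ, d] ↔ CellKappa[ρ, d] :=
  ⟨cellKappa_of_cellHC, cellHC_of_cellKappa hV hO hB⟩

/-- **`CellHC[ρ, d] ↔ CellKappaPow[ρ, d]`** (Charles–Markman-FREE form: all `κ_{θᵏ}`). Modulo {Verbitsky–Guan,
O'Grady 2008} (used by `←` only). [cite: Novario2026HodgeClassesHilbertSquares, Thm. 6.2 and §4]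
[cite: Markman2024, §1.1 Thm. 1.1] -/
theorem cellHC_iff_cellKappaPow {ρ d : ℕ} (hV : VerbitskyGuan_cohomology_K3HilbertSquareType)
    (hO : OGrady2008_dualBBFClass_algebraic) : CellHC[ρ, d] ↔ CellKappaPow[ρ, d] :=
  ⟨cellKappaPow_of_cellHC, cellHC_of_cellKappaPow hV hO⟩

end Summit.HodgeConjecture.HodgeConjecture.Theorems.MarkmanPartnerTransport.PartnerLattice

end
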